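import Literature.Probability.Percolation.SlabCircuitPositivity
import Literature.Probability.Percolation.SlabCircuitAssembly
import Literature.Probability.Percolation.SlabCircuitHubSmallness
import HarnessLib

/-!
# Newman–Tassion–Wu 2017, Theorem 3.10 — `f_p(2n, n-1) ≥ c ⟹ P_p[𝒜_{λn,2λn}] ≥ c'`, MODULO the
# corner-gluing inequalities and the small-parameter bound

Topic: `Literature/Probability/Percolation`. Thirteenth file of the port of THEOREM 3.10 of
Newman–Tassion–Wu, *Critical percolation and the minimal spanning tree in slabs* (CPAM 70 (2017);
arXiv:1512.09107, pp. 12–14).  Printed statement: "Fix `k ≥ 1`, and `ε > 0` such that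
`sup_{n ≥ 2} f_ε(2n,n-1) < 1/2`.  For every `c > 0`, there exists `λ = λ(c) ≥ 1` and `c' > 0` such that …
for every `p ∈ [ε, 1-ε]` and every `n ≥ 4r`, `f_p(2n,n-1) ≥ c ⟹ P_p[𝒜_{λn,2λn}] ≥ c'`."  The proof
first lowers `p` so that `f_p(2n,n-1) ≤ 1/2` as well ((3.34), continuity of `f` and monotonicity of
`𝒜`), then runs (3.65)–(3.74) and the gluings.  This file assembles the whole argument in the form of
the hypothesis `h310` of the lane's `Crossing.NewmanTassionWu2017_thm31_of_four`, from:

* the landed pieces: `real_circuitAround_ge_of_cornerGlue` (`SlabCircuitAssembly.lean`),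
  `real_hubCross_le_pow` (`SlabCircuitHubSmallness.lean`), `real_sideCross_ge_hubCross`
  (`SlabCircuitSideVsHub.lean`), `real_sideCross_ge_posIter` (`SlabCircuitPositivity.lean`),
  `continuous_crossingProb`, `real_circuitAround_mono`, `real_circuitAround_eq_zero_centre`;
* TWO remaining inputs, taken as hypotheses in final form:
  (HG) the corner-gluing inequalities `CornerGlue₁..₄ k N n p K` with `K` uniform on `[ε,1-ε]`
  (the located-gadget surgery — `SlabCircuitSideCrossings.lean`);
  (HL) `∃ ε₀ > 0, n₀, ∀ n ≥ n₀, ∀ p ≤ ε₀, f_p(2n,n-1) ≤ 1/2` (NTW: "by elementary arguments (e.g., by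
  bounding the expected number of open self-avoiding paths of length `m` starting from a given
  vertex)", p. 12; the tree's `real_openPathEvent_le`).

Main result: **`NTW17.h310_of_cornerGlue`**.

## Sources

* C. M. Newman, V. Tassion, W. Wu, *Critical percolation and the minimal spanning tree in slabs*,
  Comm. Pure Appl. Math. 70 (2017) 2084–2120, arXiv:1512.09107: Theorem 3.10 and its proof
  (pp. 12–14) [NewmanTassionWu2017].
-/

noncomputable section

namespace Literature.Probability.Percolation

open MeasureTheory LatticeModels
open scoped LatticeModels

namespace NTW17

variable {k : ℕ}

/-! ## Uniform constants on `[ε, 1-ε]` -/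

/-- The GL0 constant at the worst parameter of `[ε, 1-ε]`. [cite: NewmanTassionWu2017, §3.2 (Theorem 3.6: "for every p ∈ [ε, 1-ε]")] -/
def glueKmax (k : ℕ) (ε : ℝ) : ℝ :=
  (1 + (2 / ε) ^ (3 * ((5 * k + 4) * (2 * (6 * 4 + 4) + 1) ^ 2))) ^ 2 *
    (1 + (2 / ε) ^ (3 * ((5 * k + 4) * (2 * (2 * (3 * 4 + 3)) + 1) ^ 2)))

/-- `glueK k p ≤ glueKmax k ε` for `p ∈ [ε, 1-ε]`, and `1 ≤ glueK k p`. [cite: NewmanTassionWu2017, §3.2 (Theorem 3.6: constants depend only on ε and k)] -/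
theorem glueK_le_glueKmax {ε : ℝ} (hε : 0 < ε) {p : unitInterval} (hp0 : ε ≤ (p : ℝ)) (hp1 : (p : ℝ) ≤ 1 - ε) :
    1 ≤ glueK k p ∧ glueK k p ≤ glueKmax k ε := by
  have hmin : ε ≤ min (p : ℝ) (1 - p) := le_min hp0 (by linarith)
  have hb0 : 0 ≤ 2 / min (p : ℝ) (1 - p) := div_nonneg (by norm_num) (hε.le.trans hmin)
  have hb : 2 / min (p : ℝ) (1 - p) ≤ 2 / ε := div_le_div_of_nonneg_left (by norm_num) hε hmin
  have h1 : 1 ≤ 1 + (2 / min (p : ℝ) (1 - p)) ^ (3 * ((5 * k + 4) * (2 * (6 * 4 + 4) + 1) ^ 2)) :=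
    le_add_of_nonneg_right (pow_nonneg hb0 _)
  have h2 : 1 ≤ 1 + (2 / min (p : ℝ) (1 - p)) ^ (3 * ((5 * k + 4) * (2 * (2 * (3 * 4 + 3)) + 1) ^ 2)) :=
    le_add_of_nonneg_right (pow_nonneg hb0 _)
  refine ⟨?_, ?_⟩
  · unfold glueK; exact one_le_mul_of_one_le_of_one_le (one_le_pow₀ h1) h2
  · unfold glueK glueKmax
    have e1 : (2 / min (p : ℝ) (1 - p)) ^ (3 * ((5 * k + 4) * (2 * (6 * 4 + 4) + 1) ^ 2)) ≤
        (2 / ε) ^ (3 * ((5 * k + 4) * (2 * (6 * 4 + 4) + 1) ^ 2)) := pow_le_pow_left₀ hb0 hb _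
    have e2 : (2 / min (p : ℝ) (1 - p)) ^ (3 * ((5 * k + 4) * (2 * (2 * (3 * 4 + 3)) + 1) ^ 2)) ≤
        (2 / ε) ^ (3 * ((5 * k + 4) * (2 * (2 * (3 * 4 + 3)) + 1) ^ 2)) := pow_le_pow_left₀ hb0 hb _
    have hb1 : 0 ≤ 2 / ε := hb0.trans hb
    have n1 : (0 : ℝ) ≤ 1 + (2 / min (p : ℝ) (1 - p)) ^ (3 * ((5 * k + 4) * (2 * (6 * 4 + 4) + 1) ^ 2)) :=
      add_nonneg zero_le_one (pow_nonneg hb0 _)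
    have n2 : (0 : ℝ) ≤ 1 + (2 / min (p : ℝ) (1 - p)) ^ (3 * ((5 * k + 4) * (2 * (2 * (3 * 4 + 3)) + 1) ^ 2)) :=
      add_nonneg zero_le_one (pow_nonneg hb0 _)
    have n3 : (0 : ℝ) ≤ (1 + (2 / ε) ^ (3 * ((5 * k + 4) * (2 * (6 * 4 + 4) + 1) ^ 2))) ^ 2 :=
      pow_nonneg (add_nonneg zero_le_one (pow_nonneg hb1 _)) 2
    exact mul_le_mul (pow_le_pow_left₀ n1 (show _ ≤ _ by gcongr) 2) (show _ ≤ _ by gcongr) n2 n3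

/-- The iteration `posIter` is antitone in `K ≥ 1`. [cite: NewmanTassionWu2017, §3.3 (Proposition 3.9 (1))] -/
theorem posIter_anti {K K' c : ℝ} (hK : 1 ≤ K) (hKK : K ≤ K') (hc0 : 0 < c) (hc1 : c ≤ 1) :
    ∀ j, posIter K' c j ≤ posIter K c j := by
  intro j
  induction j with
  | zero => simp [posIter]
  | succ j ih =>
    obtain ⟨h0', -⟩ := posIter_pos_le (hK.trans hKK) hc0 hc1 j
    simp only [posIter]
    have hK0 : 0 < K := by linarith
    calc ((1 - Real.sqrt (1 - posIter K' c j)) * posIter K' c j) ^ 2 / K'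
        ≤ ((1 - Real.sqrt (1 - posIter K c j)) * posIter K c j) ^ 2 / K' :=
          div_le_div_of_nonneg_right (sq_step_mono h0'.le ih) (by linarith)
      _ ≤ ((1 - Real.sqrt (1 - posIter K c j)) * posIter K c j) ^ 2 / K :=
          div_le_div_of_nonneg_left (sq_nonneg _) hK0 hKK

/-- The extension constant is antitone in the GL0 constant: `κ(c)` at `p` is at least its value with
`glueKmax`. [cite: NewmanTassionWu2017, Theorem 3.10 (proof, (3.65))] -/
theorem sideHubConst_ge {ε : ℝ} (hε : 0 < ε) {p : unitInterval} (hp0 : ε ≤ (p : ℝ)) (hp1 : (p : ℝ) ≤ 1 - ε)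
    {c : ℝ} (hc0 : 0 ≤ c) :
    ((1 - Real.sqrt (1 - c)) ^ 2 * c / glueKmax k ε) ^ 3 ≤ sideHubConst k p c := by
  obtain ⟨h1, h2⟩ := glueK_le_glueKmax (k := k) hε hp0 hp1
  unfold sideHubConst
  have hK0 : 0 < glueK k p := by linarith
  have hnum : 0 ≤ (1 - Real.sqrt (1 - c)) ^ 2 * c := by positivity
  have hle : (1 - Real.sqrt (1 - c)) ^ 2 * c / glueKmax k ε ≤ (1 - Real.sqrt (1 - c)) ^ 2 * c / glueK k p :=
    div_le_div_of_nonneg_left hnum hK0 h2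
  exact pow_le_pow_left₀ (div_nonneg hnum (by linarith)) hle 3

/-! ## The theorem -/

/-- **NTW 2017, Theorem 3.10, modulo the corner-gluing inequalities (HG) and the small-parameter
bound (HL)**, in the form of `h310` of `Crossing.NewmanTassionWu2017_thm31_of_four` for every
`m₀ ≥ max n₀ 52`:
`∀ ε>0 ∀ c>0 ∃ λ ≥ 1 ∃ c'>0 ∀ p ∈ [ε,1-ε] ∀ n ≥ m₀, c ≤ f_p(2n,n-1) ⟹ ∀ z, c' ≤ P_p[circuitAround k z (λn) (2λn)]`.
Proof: lower `p` to `p' ∈ [min ε ε₀, p]` with `min c ½ ≤ f_{p'}(2n,n-1) ≤ ½` (HL, continuity, IVT);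
at `p'`: the hub crossings are `≤ 2^{-m}` (`real_hubCross_le_pow`), the side crossings are
`≥ κ · hub` (`real_sideCross_ge_hubCross`) and `≥ g > 0` (`real_sideCross_ge_posIter`); with
`2^{-m} ≤ κ/8` the chain `real_circuitAround_ge_of_cornerGlue` gives
`P[circuitAround 0 N (N+n+1)] ≥ g⁴/(2(1+K)⁴)` for `N = λn`, `λ = 2m+2`; finally monotonicity in the
annulus, in `p`, and translation to the centre `z`. [cite: NewmanTassionWu2017, Theorem 3.10] -/
theorem h310_of_cornerGlue (hk : 1 ≤ k) {m₀ n₀ : ℕ} (hm₀ : 52 ≤ m₀) (hm₀' : n₀ ≤ m₀)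
    (HG : ∀ ε : ℝ, 0 < ε → ∃ K : ℝ, 0 ≤ K ∧ ∀ p : unitInterval, ε ≤ (p : ℝ) → (p : ℝ) ≤ 1 - ε →
      ∀ N n : ℕ, 2 ≤ N → CornerGlue₁ k N n p K ∧ CornerGlue₂ k N n p K ∧ CornerGlue₃ k N n p K ∧
        CornerGlue₄ k N n p K)
    {ε₀ : ℝ} (hε₀ : 0 < ε₀)
    (HL : ∀ n : ℕ, n₀ ≤ n → ∀ p : unitInterval, (p : ℝ) ≤ ε₀ → crossingProb k p (2 * n) (n - 1) ≤ 1 / 2) :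
    ∀ ε : ℝ, 0 < ε → ∀ c : ℝ, 0 < c → ∃ lam : ℕ, 1 ≤ lam ∧ ∃ c' : ℝ, 0 < c' ∧ ∀ p : unitInterval,
      ε ≤ (p : ℝ) → (p : ℝ) ≤ 1 - ε → ∀ n : ℕ, m₀ ≤ n → c ≤ crossingProb k p (2 * n) (n - 1) →
      ∀ z : ℤ × ℤ, c' ≤ (bondPercolation (slabGraph 3 k) p).real (circuitAround k z (lam * n) (2 * (lam * n))) := by
  intro ε hε c hc
  -- constants
  set ε' : ℝ := min ε ε₀ with hε'
  have hε'0 : 0 < ε' := lt_min hε hε₀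
  obtain ⟨K, hK0, hKG⟩ := HG ε' hε'0
  set c₂ : ℝ := min c (1 / 2) with hc₂
  have hc₂0 : 0 < c₂ := lt_min hc (by norm_num)
  have hc₂1 : c₂ ≤ 1 := (min_le_right _ _).trans (by norm_num)
  set Kmax : ℝ := glueKmax k ε' with hKmax
  set κ : ℝ := ((1 - Real.sqrt (1 - c₂)) ^ 2 * c₂ / Kmax) ^ 3 with hκ
  have hKmax1 : 1 ≤ Kmax := by
    rw [hKmax]; unfold glueKmax
    have hb : 0 ≤ 2 / ε' := by positivity
    refine one_le_mul_of_one_le_of_one_le (one_le_pow₀ ?_) ?_ <;> exact le_add_of_nonneg_right (pow_nonneg hb _)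
  have hκ0 : 0 < κ := by
    rw [hκ]
    have : 0 < 1 - Real.sqrt (1 - c₂) := by
      rw [sub_pos, Real.sqrt_lt' one_pos]; linarith
    positivity
  -- number of blocks `m` with `(1/2)^m ≤ κ/8`, then `λ = 2m + 2`
  obtain ⟨m, hm⟩ := exists_pow_lt_of_lt_one (show 0 < κ / 8 by positivity) (show (1 / 2 : ℝ) < 1 by norm_num)
  set lam : ℕ := 2 * m + 2 with hlam
  -- the positive lower bound
  set j : ℕ := 2 * lam + 2 with hj
  set g : ℝ := posIter Kmax c₂ j with hg
  have hg0 : 0 < g := (posIter_pos_le hKmax1 hc₂0 hc₂1 j).1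
  refine ⟨lam, by omega, (1 / 2) * (g * g * g * g) / (1 + K) ^ 4, by positivity, ?_⟩
  intro p hpε hp1ε n hn hcn z
  have hn52 : 52 ≤ n := hm₀.trans hn
  have hn1 : 1 ≤ n := by omega
  set N : ℕ := lam * n with hN
  have h2n : 2 * n ≤ (2 * m + 2) * n := Nat.mul_le_mul_right n (by omega)
  have hNn : n ≤ N := by rw [hN, hlam]; omega
  have hNn1 : n + 1 ≤ N := by rw [hN, hlam]; omega
  have hN2 : 2 ≤ N := by omega
  -- Step L: lower the parameter
  have hεle1 : ε ≤ 1 / 2 := by linarith [hpε, hp1ε]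
  obtain ⟨p', hp'ε, hp'p, hcp', hp'half⟩ : ∃ p' : unitInterval, ε' ≤ (p' : ℝ) ∧ p' ≤ p ∧
      c₂ ≤ crossingProb k p' (2 * n) (n - 1) ∧ crossingProb k p' (2 * n) (n - 1) ≤ 1 / 2 := by
    by_cases hhalf : crossingProb k p (2 * n) (n - 1) ≤ 1 / 2
    · exact ⟨p, (min_le_left _ _).trans hpε, le_rfl, (min_le_left _ _).trans hcn, hhalf⟩
    · rw [not_le] at hhalf
      -- the point `p₀ = ε'` of `[0,1]`
      have hε'1 : ε' ≤ 1 := (min_le_left _ _).trans (by linarith)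
      set F : ℝ → ℝ := fun t => crossingProb k (Set.projIcc (0 : ℝ) 1 zero_le_one t) (2 * n) (n - 1) with hF
      have hFc : Continuous F := (continuous_crossingProb (k := k) (2 * n) (n - 1)).comp continuous_projIcc
      have hFε : F ε' ≤ 1 / 2 := by
        refine HL n (hm₀'.trans hn) _ ?_
        rw [Set.projIcc_of_mem _ ⟨hε'0.le, hε'1⟩]
        exact min_le_right _ _
      have hFp : F p = crossingProb k p (2 * n) (n - 1) := by
        simp only [hF]; rw [Set.projIcc_val]
      have hεp : ε' ≤ (p : ℝ) := (min_le_left _ _).trans hpε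
      obtain ⟨t, ⟨ht1, ht2⟩, hFt⟩ : ∃ t ∈ Set.Icc ε' (p : ℝ), F t = 1 / 2 :=
        intermediate_value_Icc hεp hFc.continuousOn ⟨hFε, by rw [hFp]; exact hhalf.le⟩
      have htI : t ∈ Set.Icc (0 : ℝ) 1 := ⟨hε'0.le.trans ht1, ht2.trans p.2.2⟩
      refine ⟨Set.projIcc 0 1 zero_le_one t, ?_, ?_, ?_, ?_⟩
      · rw [Set.projIcc_of_mem _ htI]; exact ht1
      · change (Set.projIcc 0 1 zero_le_one t : ℝ) ≤ (p : ℝ)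
        rw [Set.projIcc_of_mem _ htI]; exact ht2
      · have : F t = crossingProb k (Set.projIcc 0 1 zero_le_one t) (2 * n) (n - 1) := rfl
        rw [← this, hFt]; exact min_le_right _ _
      · have : F t = crossingProb k (Set.projIcc 0 1 zero_le_one t) (2 * n) (n - 1) := rfl
        rw [← this, hFt]
  have hp'0 : 0 < (p' : ℝ) := hε'0.trans_le hp'ε
  have hp'1ε : (p' : ℝ) ≤ 1 - ε' := by
    have : (p' : ℝ) ≤ (p : ℝ) := hp'p
    have : ε' ≤ ε := min_le_left _ _
    linarith
  have hp'1 : (p' : ℝ) < 1 := by linarith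
  set P := bondPercolation (slabGraph 3 k) p' with hP
  -- Step M: the main estimate at `p'`
  obtain ⟨hG1, hG2, hG3, hG4⟩ := hKG p' hp'ε hp'1ε N n hN2
  -- hub smallness
  have hmN : (m : ℤ) * (2 * n + 1) ≤ 2 * (N : ℤ) - 3 := by
    have hmn : (m : ℤ) * 1 ≤ (m : ℤ) * n := mul_le_mul_of_nonneg_left (by exact_mod_cast hn1) (by positivity)
    have hNeq : (N : ℤ) = (2 * m + 2) * n := by rw [hN, hlam]; push_cast; ring
    rw [hNeq]
    have hn1' : (1 : ℤ) ≤ n := by exact_mod_cast hn1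
    nlinarith
  obtain ⟨sT, sR, sB, sL⟩ := real_hubCross_le_pow (k := k) (N := N) p' hn1 hmN
  have hfm : crossingProb k p' (2 * n) (n - 1) ^ m ≤ κ / 8 := by
    refine le_trans ?_ hm.le
    exact pow_le_pow_left₀ (by rw [crossingProb_eq]; exact measureReal_nonneg) hp'half m
  -- side vs hub
  obtain ⟨eT, eR, eB, eL⟩ := real_sideCross_ge_hubCross (k := k) hk hn52 hNn p' hp'0 hp'1 hc₂0.le hcp'
  have hκle : κ ≤ sideHubConst k p' c₂ := sideHubConst_ge (k := k) hε'0 hp'ε hp'1ε hc₂0.le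
  -- `P[hub]² ≤ δ P[side]` with `δ = 1/8`
  have defect : ∀ {H S : ℝ}, 0 ≤ H → H ≤ crossingProb k p' (2 * n) (n - 1) ^ m →
      sideHubConst k p' c₂ * H ≤ S → H ^ 2 ≤ (1 / 8) * S := by
    intro H S hH0 hHm hHS
    have h1 : H ≤ κ / 8 := hHm.trans hfm
    have h2 : κ * H ≤ S := (mul_le_mul_of_nonneg_right hκle hH0).trans hHS
    nlinarith
  have dT := defect measureReal_nonneg sT eT
  have dR := defect measureReal_nonneg sR eR
  have dB := defect measureReal_nonneg sB eB
  have dL := defect measureReal_nonneg sL eL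
  have main := real_circuitAround_ge_of_cornerGlue (k := k) (n := n) hN2 p' hK0 hG1 hG2 hG3 hG4
    (δ := 1 / 8) (by norm_num) (by norm_num) dT dR dB dL
  -- positivity of the side crossings
  have hjN : 2 * (N : ℤ) + 2 * n + 1 ≤ ((n : ℤ) - 1) + ((j : ℤ) + 1) * ((n : ℤ) + 1) := by
    have hNeq : (N : ℤ) = (lam : ℤ) * n := by rw [hN]; push_cast; ring
    have hjeq : (j : ℤ) = 2 * lam + 2 := by rw [hj]; push_cast; ring
    rw [hNeq, hjeq]
    have hl0 : (0 : ℤ) ≤ lam := by positivity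
    have hn1' : (1 : ℤ) ≤ n := by exact_mod_cast hn1
    nlinarith
  obtain ⟨gT, gR, gB, gL⟩ := real_sideCross_ge_posIter (k := k) hk hn52 hNn p' hp'0 hp'1 hc₂0 hcp' hjN
  obtain ⟨hK1p, hKle⟩ := glueK_le_glueKmax (k := k) hε'0 hp'ε hp'1ε
  have hgp : g ≤ posIter (glueK k p') c₂ j := posIter_anti hK1p hKle hc₂0 hc₂1 j
  have lT := hgp.trans gT; have lR := hgp.trans gR; have lB := hgp.trans gB; have lL := hgp.trans gL
  have hprod : g * g * g * g ≤ P.real (sideCrossT k N n) * P.real (sideCrossR k N n) * P.real (sideCrossB k N n) *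
      P.real (sideCrossL k N n) := by
    have h0 := hg0.le
    refine mul_le_mul (mul_le_mul (mul_le_mul lT lR h0 measureReal_nonneg) lB h0 ?_) lL h0 ?_
    · exact mul_nonneg measureReal_nonneg measureReal_nonneg
    · exact mul_nonneg (mul_nonneg measureReal_nonneg measureReal_nonneg) measureReal_nonneg
  have hK4 : 0 < (1 + K) ^ 4 := by positivity
  have hcirc : (1 / 2) * (g * g * g * g) / (1 + K) ^ 4 ≤ P.real (circuitAround k (0, 0) N (N + n + 1)) := by
    rw [div_le_iff₀ hK4]
    calc (1 / 2) * (g * g * g * g) ≤ (1 / 2) * (P.real (sideCrossT k N n) * P.real (sideCrossR k N n) *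
          P.real (sideCrossB k N n) * P.real (sideCrossL k N n)) := by gcongr
      _ ≤ (1 + K) ^ 4 * P.real (circuitAround k (0, 0) N (N + n + 1)) := main
      _ = P.real (circuitAround k (0, 0) N (N + n + 1)) * (1 + K) ^ 4 := mul_comm _ _
  -- Step T: the annulus `A_{N, 2N}`, the parameter `p`, the centre `z`
  have hann : circuitAround k (0, 0) N (N + n + 1) ⊆ circuitAround k (0, 0) (lam * n) (2 * (lam * n)) := by
    rw [← hN]
    exact circuitAround_mono le_rfl (by omega)
  calc (1 / 2) * (g * g * g * g) / (1 + K) ^ 4 ≤ P.real (circuitAround k (0, 0) N (N + n + 1)) := hcirc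
    _ ≤ P.real (circuitAround k (0, 0) (lam * n) (2 * (lam * n))) := measureReal_mono hann
    _ ≤ (bondPercolation (slabGraph 3 k) p).real (circuitAround k (0, 0) (lam * n) (2 * (lam * n))) :=
        real_circuitAround_mono hp'p _ _ _
    _ = (bondPercolation (slabGraph 3 k) p).real (circuitAround k z (lam * n) (2 * (lam * n))) :=
        (real_circuitAround_eq_zero_centre p z _ _).symm

end NTW17

end Literature.Probability.Percolation

end
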